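import Summits.CriticalPhenomena.PercolationContinuityZ3.Theorems.PercNearOneGluingNoHeavyRsw3InvasionOutletRecords
import HarnessLib

/-!
# RSW3 lane (P2, gen 29): INVASION PERCOLATION XXIX — THE INVASION TREE: it spans the invaded region, EVERY OUTLET BOND IS A CUT-EDGE whose
# near side is exactly the (finite) region invaded up to the outlet, and EVERY RAY OF THE TREE LEAVES THAT REGION THROUGH THE OUTLET, OUTWARDS
# (every graph, every label field — the combinatorial core of "the invasion tree has one end", Lyons–Peres–Schramm 2006, Thm. 3.12)

builds on p205010 (kernel theorem, internal audit signed; external expert review pending) — NOT used in this file (deterministic).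

Cell `prim-rsw3`, prover seat `prim-rsw3-p2` (gen 29), memo `run/shared/lean/prim/rsw3/P2-RSWLITE.md` §36.  Support file
(`--supports stmt-CriticalPhenomena-4575`); no definitions, no named facts, no sorries.  Notation: `I_n = invasion G U o n`, `x_n = acceptedLabel G U o n`,
`T = Invasion.tree G U o` (the bonds absorbed by the invasion, as a simple graph on `V`), `IsOutlet G U o m :⟺ ∀ n > m, x_n < x_m`; at an outlet
step `m` with absorbed dart `a = (a.1, a.2)` the OUTLET BOND is `ê = s(a.1, a.2)` (`a.1 ∈ I_m`, `a.2 ∉ I_m`).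

* §1 `tree_le` (`T ≤ G`), `tree_adj_of_newDart`, **`tree_reachable_iff_mem_invadedRegion`** — `T` connects the root to exactly the invaded vertices.
* §2 THE CUT-EDGE THEOREM **`reachable_deleteEdges_outlet_iff`** — for an outlet step `m`: in `T ∖ ê` the vertices reachable from the root are
  EXACTLY `I_m` (finite), while every vertex invaded after `m` is reachable from the far endpoint `a.2` in `T ∖ ê`
  (`reachable_deleteEdges_outlet_snd`); so `ê` is a bridge of `T` separating the root from all but finitely many invaded vertices
  (`not_reachable_deleteEdges_outlet`, `infinite_setOf_not_reachable_deleteEdges_outlet`) — LPS06: "the edge `e_k` separates `o` from `∞` in the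
  invasion tree of `o`".  Ingredients: the greedy separation lemma of file XXVIII (after an outlet no absorbed dart starts in `I_m`) and "a bond is
  absorbed at most once".
* §3 RAYS **`exists_outlet_crossing_of_path`** — a `T`-path starting in `I_m` that ever leaves `I_m` does so for the first time ALONG THE OUTLET DART,
  from `a.1` to `a.2`; hence every self-avoiding ray of `T` from the root passes through every outlet dart, outwards (`ray_crosses_outlet`), and any
  two rays from the root share the endpoints of every outlet bond (`rays_meet_at_outlet`).  With infinitely many outlets (file XXX, a.s. on `ℤ^d`)
  this is ONE END.

References: R. Lyons, Y. Peres, O. Schramm, Ann. Probab. 34 (2006) 1665–1692, §3 and Thm. 3.12 (proof) [LyonsPeresSchramm2006]; R. Lyons, Y. Peres,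
*Probability on Trees and Networks* (2016), §11.2, Thm. 11.12 [LyonsPeres2016]; M. Damron, A. Sapozhnikov, B. Vágvölgyi, Ann. Probab. 37 (2009), §1.1.
-/

noncomputable section

namespace Summit.CriticalPhenomena.PercolationContinuityZ3.Theorems.Rsw3

open Finset Filter Literature.Probability.Percolation Literature.Probability.Percolation.Invasion

variable {V : Type*} [DecidableEq V] {G : SimpleGraph V} [G.LocallyFinite]

/-! ## §1 The invasion tree spans the invaded region -/

/-- The bond of an absorbed dart is a tree edge. [cite: LyonsPeresSchramm2006, §3 (the invasion tree)] -/
theorem mem_treeEdges_of_newDart {U : Sym2 V → ℝ} {o : V} {n : ℕ} {a : V × V} (ha : newDart G U (invasion G U o n) = some a) :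
    s(a.1, a.2) ∈ treeEdges G U o :=
  ⟨n, a, ha, rfl⟩

/-- An absorbed dart is a tree adjacency. [cite: LyonsPeresSchramm2006, §3 (the invasion tree)] -/
theorem tree_adj_of_newDart {U : Sym2 V → ℝ} {o : V} {n : ℕ} {a : V × V} (ha : newDart G U (invasion G U o n) = some a) :
    (tree G U o).Adj a.1 a.2 :=
  (tree_adj G).2 ⟨mem_treeEdges_of_newDart ha, (adj_of_newDart ha).ne⟩

/-- **The invasion tree is a subgraph of `G`.** [cite: LyonsPeresSchramm2006, §3 (the invasion tree)] -/
theorem tree_le (U : Sym2 V → ℝ) (o : V) : tree G U o ≤ G := by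
  intro u v h
  obtain ⟨⟨n, a, ha, he⟩, -⟩ := (tree_adj G).1 h
  have hadj := adj_of_newDart ha
  rcases Sym2.eq_iff.1 he with ⟨h1, h2⟩ | ⟨h1, h2⟩
  · rw [← h1, ← h2]; exact hadj
  · rw [← h1, ← h2]; exact hadj.symm

/-- Every tree adjacency comes from an absorbed dart, in one of the two orientations. [cite: LyonsPeresSchramm2006, §3 (the invasion tree)] -/
theorem exists_newDart_of_tree_adj {U : Sym2 V → ℝ} {o : V} {u v : V} (h : (tree G U o).Adj u v) :
    ∃ n : ℕ, ∃ a : V × V, newDart G U (invasion G U o n) = some a ∧ u ∈ s(a.1, a.2) ∧ v ∈ s(a.1, a.2) := by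
  obtain ⟨⟨n, a, ha, he⟩, -⟩ := (tree_adj G).1 h
  exact ⟨n, a, ha, by rw [he]; exact Sym2.mem_mk_left _ _, by rw [he]; exact Sym2.mem_mk_right _ _⟩

/-- Both endpoints of a tree edge are invaded. [cite: LyonsPeresSchramm2006, §3 (the invasion tree)] -/
theorem mem_invadedRegion_of_tree_adj {U : Sym2 V → ℝ} {o : V} {u v : V} (h : (tree G U o).Adj u v) :
    v ∈ invadedRegion G U o := by
  obtain ⟨n, a, ha, -, hv⟩ := exists_newDart_of_tree_adj h
  exact (mem_invadedRegion G).2 ⟨n + 1, mem_invasion_of_lt_of_mem_sym2 (Nat.lt_succ_self n) ha hv⟩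

/-- Every vertex of `I_n` is joined to the root inside the invasion tree. [cite: LyonsPeresSchramm2006, §3 (the invasion tree)] -/
theorem tree_reachable_of_mem_invasion {U : Sym2 V → ℝ} {o : V} : ∀ {n : ℕ} {v : V}, v ∈ invasion G U o n → (tree G U o).Reachable o v
  | 0, v, hv => by
    rw [invasion_zero, mem_singleton] at hv
    rw [hv]
  | n + 1, v, hv => by
    rw [invasion_succ] at hv
    cases hd : newDart G U (invasion G U o n) with
    | none =>
      rw [step_of_eq_none G hd] at hv
      exact tree_reachable_of_mem_invasion hv
    | some a =>
      rw [step_of_eq_some G hd, mem_insert] at hv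
      rcases hv with rfl | hv
      · exact (tree_reachable_of_mem_invasion (fst_mem_of_newDart hd)).trans (tree_adj_of_newDart hd).reachable
      · exact tree_reachable_of_mem_invasion hv

/-- A tree walk starting at an invaded vertex ends at an invaded vertex. [cite: LyonsPeresSchramm2006, §3 (the invasion tree)] -/
theorem mem_invadedRegion_of_tree_walk {U : Sym2 V → ℝ} {o : V} {u w : V} (p : (tree G U o).Walk u w) (hu : u ∈ invadedRegion G U o) :
    w ∈ invadedRegion G U o := by
  induction p with
  | nil => exact hu
  | cons h _ ih => exact ih (mem_invadedRegion_of_tree_adj h)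

/-- **The invasion tree joins the root to exactly the invaded vertices.** [cite: LyonsPeresSchramm2006, §3 (the invasion tree)] -/
theorem tree_reachable_iff_mem_invadedRegion {U : Sym2 V → ℝ} {o v : V} : (tree G U o).Reachable o v ↔ v ∈ invadedRegion G U o := by
  refine ⟨fun h => h.elim fun p => mem_invadedRegion_of_tree_walk p ((mem_invadedRegion G).2 ⟨0, root_mem_invasion U o 0⟩), fun h => ?_⟩
  obtain ⟨n, hn⟩ := (mem_invadedRegion G).1 h
  exact tree_reachable_of_mem_invasion hn

/-! ## §2 The outlet bond is a cut-edge of the invasion tree separating the root from infinity -/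

/-- **Cut-edge theorem, near side.**  Let `m` be an outlet step with absorbed dart `a`.  In the invasion tree with the outlet bond `s(a.1, a.2)` removed,
every vertex reachable from the root lies in `I_m`: a tree walk can leave `I_m` only along a bond absorbed at a time `n` with one endpoint inside and one
outside `I_m`, and by the greedy separation lemma the only such time is `n = m`, whose bond is the removed one.
[cite: LyonsPeresSchramm2006, Thm. 3.12 (proof: "the edge e_k separates o from infinity in the invasion tree of o")] -/
theorem mem_invasion_of_reachable_deleteEdges_outlet {U : Sym2 V → ℝ} {o : V} {m : ℕ} (hm : IsOutlet G U o m) {a : V × V}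
    (ha : newDart G U (invasion G U o m) = some a) {v : V} (h : ((tree G U o).deleteEdges {s(a.1, a.2)}).Reachable o v) :
    v ∈ invasion G U o m := by
  suffices H : ∀ {u w : V} (_ : ((tree G U o).deleteEdges {s(a.1, a.2)}).Walk u w), u ∈ invasion G U o m → w ∈ invasion G U o m from
    h.elim fun p => H p (root_mem_invasion U o m)
  intro u w p
  induction p with
  | nil => exact id
  | @cons u x w hux _ ih =>
    intro hu
    refine ih ?_
    rw [SimpleGraph.deleteEdges_adj] at hux
    obtain ⟨hadj, hne⟩ := hux
    obtain ⟨n, b, hb, huB, hxB⟩ := exists_newDart_of_tree_adj hadj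
    by_contra hx
    obtain rfl : n = m := eq_of_isOutlet_of_mem_of_not_mem hm hb huB hxB hu hx
    obtain rfl : b = a := newDart_some_inj hb ha
    exact hne (Set.mem_singleton_iff.2 ((Sym2.mem_and_mem_iff (G.ne_of_adj ((tree_le U o) hadj))).1 ⟨huB, hxB⟩).symm)

/-- **Cut-edge theorem, near side (converse).**  Every vertex of `I_m` is joined to the root in the tree WITHOUT the bond absorbed at time `m`
(the bonds absorbed before `m` suffice, and a bond is absorbed only once). [cite: LyonsPeresSchramm2006, Thm. 3.12 (proof)] -/
theorem reachable_deleteEdges_of_mem_invasion {U : Sym2 V → ℝ} {o : V} {m : ℕ} {a : V × V} (ha : newDart G U (invasion G U o m) = some a) :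
    ∀ {n : ℕ}, n ≤ m → ∀ {v : V}, v ∈ invasion G U o n → ((tree G U o).deleteEdges {s(a.1, a.2)}).Reachable o v
  | 0, _, v, hv => by
    rw [invasion_zero, mem_singleton] at hv
    rw [hv]
  | n + 1, hn, v, hv => by
    have hn' : n < m := Nat.lt_of_succ_le hn
    rw [invasion_succ] at hv
    cases hd : newDart G U (invasion G U o n) with
    | none =>
      rw [step_of_eq_none G hd] at hv
      exact reachable_deleteEdges_of_mem_invasion ha hn'.le hv
    | some b =>
      rw [step_of_eq_some G hd, mem_insert] at hv
      rcases hv with rfl | hv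
      · refine (reachable_deleteEdges_of_mem_invasion ha hn'.le (fst_mem_of_newDart hd)).trans (SimpleGraph.Adj.reachable ?_)
        rw [SimpleGraph.deleteEdges_adj, Set.mem_singleton_iff]
        exact ⟨tree_adj_of_newDart hd, fun he => absurd (eq_of_newDart_sym2_eq hd ha he) hn'.ne⟩
      · exact reachable_deleteEdges_of_mem_invasion ha hn'.le hv

/-- **THE OUTLET BOND IS A CUT-EDGE WHOSE ROOT SIDE IS EXACTLY `I_m`.**  For an outlet step `m` with absorbed dart `a`:
`(T ∖ s(a.1,a.2)).Reachable o v ↔ v ∈ I_m`. [cite: LyonsPeresSchramm2006, Thm. 3.12 (proof: e_k separates o from infinity)] -/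
theorem reachable_deleteEdges_outlet_iff {U : Sym2 V → ℝ} {o : V} {m : ℕ} (hm : IsOutlet G U o m) {a : V × V}
    (ha : newDart G U (invasion G U o m) = some a) {v : V} :
    ((tree G U o).deleteEdges {s(a.1, a.2)}).Reachable o v ↔ v ∈ invasion G U o m :=
  ⟨mem_invasion_of_reachable_deleteEdges_outlet hm ha, reachable_deleteEdges_of_mem_invasion ha le_rfl⟩

/-- The root's side of an outlet bond is finite. [cite: LyonsPeresSchramm2006, Thm. 3.12 (proof)] -/
theorem finite_setOf_reachable_deleteEdges_outlet {U : Sym2 V → ℝ} {o : V} {m : ℕ} (hm : IsOutlet G U o m) {a : V × V}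
    (ha : newDart G U (invasion G U o m) = some a) : {v | ((tree G U o).deleteEdges {s(a.1, a.2)}).Reachable o v}.Finite :=
  (invasion G U o m).finite_toSet.subset fun _ hv => (reachable_deleteEdges_outlet_iff hm ha).1 hv

/-- **A vertex invaded after the outlet is cut off from the root by the outlet bond.** [cite: LyonsPeresSchramm2006, Thm. 3.12 (proof)] -/
theorem not_reachable_deleteEdges_outlet {U : Sym2 V → ℝ} {o : V} {m : ℕ} (hm : IsOutlet G U o m) {a : V × V}
    (ha : newDart G U (invasion G U o m) = some a) {v : V} (hv : v ∉ invasion G U o m) :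
    ¬ ((tree G U o).deleteEdges {s(a.1, a.2)}).Reachable o v :=
  fun h => hv ((reachable_deleteEdges_outlet_iff hm ha).1 h)

/-- **Far side.**  Every vertex invaded after the outlet is joined to the far endpoint `a.2` of the outlet bond in `T ∖ s(a.1,a.2)`: the later bonds
hang off `a.2` (greedy separation lemma). [cite: LyonsPeresSchramm2006, Thm. 3.12 (proof)] -/
theorem reachable_deleteEdges_outlet_snd {U : Sym2 V → ℝ} {o : V} {m : ℕ} (hm : IsOutlet G U o m) {a : V × V}
    (ha : newDart G U (invasion G U o m) = some a) :
    ∀ {n : ℕ} {v : V}, v ∈ invasion G U o n → v ∉ invasion G U o m → ((tree G U o).deleteEdges {s(a.1, a.2)}).Reachable a.2 v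
  | 0, v, hv, hvm => absurd (invasion_mono U o (Nat.zero_le m) hv) hvm
  | n + 1, v, hv, hvm => by
    rw [invasion_succ] at hv
    cases hd : newDart G U (invasion G U o n) with
    | none =>
      rw [step_of_eq_none G hd] at hv
      exact reachable_deleteEdges_outlet_snd hm ha hv hvm
    | some b =>
      rw [step_of_eq_some G hd, mem_insert] at hv
      rcases hv with rfl | hv
      · -- `v = b.2` is absorbed at time `n`; `n ≥ m` since `b.2 ∉ I_m`
        rcases lt_trichotomy n m with hlt | rfl | hgt
        · exact absurd (snd_mem_invasion_of_lt hlt hd) hvm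
        · obtain rfl : b = a := newDart_some_inj hd ha
          rfl
        · have h1 : b.1 ∉ invasion G U o m := fst_not_mem_invasion_of_isOutlet hm hgt hd
          refine (reachable_deleteEdges_outlet_snd hm ha (fst_mem_of_newDart hd) h1).trans (SimpleGraph.Adj.reachable ?_)
          rw [SimpleGraph.deleteEdges_adj, Set.mem_singleton_iff]
          exact ⟨tree_adj_of_newDart hd, fun he => absurd (eq_of_newDart_sym2_eq hd ha he) hgt.ne'⟩
      · exact reachable_deleteEdges_outlet_snd hm ha hv hvm

/-- On an infinite connected graph the outlet bond separates the root from INFINITELY many invaded vertices (the invaded region is infinite, `I_m`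
is finite). [cite: LyonsPeresSchramm2006, Thm. 3.12 (proof: e_k separates o from infinity)] -/
theorem infinite_setOf_not_reachable_deleteEdges_outlet [Infinite V] (hG : G.Preconnected) {U : Sym2 V → ℝ} {o : V} {m : ℕ}
    (hm : IsOutlet G U o m) {a : V × V} (ha : newDart G U (invasion G U o m) = some a) :
    {v | v ∈ invadedRegion G U o ∧ ¬ ((tree G U o).deleteEdges {s(a.1, a.2)}).Reachable o v}.Infinite := by
  have hinf := (invadedRegion_infinite hG U o).sdiff (invasion G U o m).finite_toSet
  refine hinf.mono fun v hv => ⟨hv.1, not_reachable_deleteEdges_outlet hm ha ?_⟩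
  exact fun h => hv.2 (Finset.mem_coe.2 h)

/-! ## §3 Rays of the invasion tree cross every outlet, outwards -/

/-- **First exit through the outlet.**  A tree path `r 0 ~ r 1 ~ ⋯` starting in `I_m` that leaves `I_m` at some time does so, the FIRST time, along the
outlet dart: `r i = a.1 ∈ I_m`, `r (i+1) = a.2 ∉ I_m`, all earlier vertices in `I_m`. [cite: LyonsPeresSchramm2006, Thm. 3.12 (proof)] -/
theorem exists_outlet_crossing_of_path {U : Sym2 V → ℝ} {o : V} {m : ℕ} (hm : IsOutlet G U o m) {a : V × V}
    (ha : newDart G U (invasion G U o m) = some a) (r : ℕ → V) (h0 : r 0 ∈ invasion G U o m)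
    (hadj : ∀ i, (tree G U o).Adj (r i) (r (i + 1))) (hex : ∃ i, r i ∉ invasion G U o m) :
    ∃ i, (∀ j ≤ i, r j ∈ invasion G U o m) ∧ r i = a.1 ∧ r (i + 1) = a.2 := by
  classical
  have hspec : r (Nat.find hex) ∉ invasion G U o m := Nat.find_spec hex
  have hne0 : Nat.find hex ≠ 0 := fun h => by rw [h] at hspec; exact hspec h0
  obtain ⟨i, hi⟩ := Nat.exists_eq_succ_of_ne_zero hne0
  have hin : ∀ j ≤ i, r j ∈ invasion G U o m := fun j hj => by
    by_contra h
    exact Nat.find_min hex (show j < Nat.find hex by omega) h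
  have hri : r i ∈ invasion G U o m := hin i le_rfl
  have hri1 : r (i + 1) ∉ invasion G U o m := by
    have h := hspec
    rw [hi] at h
    exact h
  obtain ⟨n, b, hb, h1, h2⟩ := exists_newDart_of_tree_adj (hadj i)
  obtain rfl : n = m := eq_of_isOutlet_of_mem_of_not_mem hm hb h1 h2 hri hri1
  obtain rfl : b = a := newDart_some_inj hb ha
  refine ⟨i, hin, ?_, ?_⟩
  · rcases Sym2.mem_iff.1 h1 with h1 | h1
    · exact h1
    · exact absurd (h1 ▸ hri) (snd_not_mem_of_newDart hb)
  · rcases Sym2.mem_iff.1 h2 with h2 | h2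
    · exact absurd (h2 ▸ fst_mem_of_newDart hb) hri1
    · exact h2

omit [DecidableEq V] [G.LocallyFinite] in
/-- A self-avoiding sequence of vertices leaves every finite set. [folklore] -/
theorem exists_not_mem_of_injective {r : ℕ → V} (hr : Function.Injective r) (S : Finset V) : ∃ i, r i ∉ S := by
  by_contra h
  push Not at h
  exact (Set.infinite_range_of_injective hr) (S.finite_toSet.subset (Set.range_subset_iff.2 fun i => Finset.mem_coe.2 (h i)))

/-- **Every ray of the invasion tree from the root crosses every outlet dart, outwards.**  A self-avoiding tree path `o = r 0 ~ r 1 ~ ⋯` satisfies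
`r i = a.1`, `r (i+1) = a.2` for some `i`, for every outlet step `m` with absorbed dart `a`.
[cite: LyonsPeresSchramm2006, Thm. 3.12 (proof: "It follows that the invasion tree of o has a.s. one end")] -/
theorem ray_crosses_outlet {U : Sym2 V → ℝ} {o : V} {m : ℕ} (hm : IsOutlet G U o m) {a : V × V}
    (ha : newDart G U (invasion G U o m) = some a) {r : ℕ → V} (hr : Function.Injective r) (h0 : r 0 = o)
    (hadj : ∀ i, (tree G U o).Adj (r i) (r (i + 1))) : ∃ i, (∀ j ≤ i, r j ∈ invasion G U o m) ∧ r i = a.1 ∧ r (i + 1) = a.2 :=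
  exists_outlet_crossing_of_path hm ha r (by rw [h0]; exact root_mem_invasion U o m) hadj (exists_not_mem_of_injective hr _)

/-- **Two rays from the root meet at every outlet** (both pass through the outlet dart `a.1 → a.2`); with infinitely many outlets, any two rays of the
invasion tree have infinitely many common vertices — the tree has ONE END. [cite: LyonsPeresSchramm2006, Thm. 3.12 (proof)] -/
theorem rays_meet_at_outlet {U : Sym2 V → ℝ} {o : V} {m : ℕ} (hm : IsOutlet G U o m) {a : V × V}
    (ha : newDart G U (invasion G U o m) = some a) {r r' : ℕ → V} (hr : Function.Injective r) (hr' : Function.Injective r')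
    (h0 : r 0 = o) (h0' : r' 0 = o) (hadj : ∀ i, (tree G U o).Adj (r i) (r (i + 1))) (hadj' : ∀ i, (tree G U o).Adj (r' i) (r' (i + 1))) :
    ∃ i i', r i = r' i' ∧ r (i + 1) = r' (i' + 1) ∧ r (i + 1) = a.2 := by
  obtain ⟨i, -, hi1, hi2⟩ := ray_crosses_outlet hm ha hr h0 hadj
  obtain ⟨i', -, hi1', hi2'⟩ := ray_crosses_outlet hm ha hr' h0' hadj'
  exact ⟨i, i', hi1.trans hi1'.symm, hi2.trans hi2'.symm, hi2⟩

/-- **Crossing indices are unbounded.**  On an infinite connected graph with outlets beyond every time, a self-avoiding ray of the invasion tree from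
the root crosses outlets at arbitrarily late indices: the crossing index strictly increases from one outlet to any later one (the far endpoint of the
earlier outlet is still inside the later pond closure). [cite: LyonsPeresSchramm2006, Thm. 3.12 (proof)] -/
theorem exists_outlet_crossing_ge [Infinite V] (hG : G.Preconnected) {U : Sym2 V → ℝ} {o : V} (hout : ∀ k, ∃ m, k ≤ m ∧ IsOutlet G U o m)
    {r : ℕ → V} (hr : Function.Injective r) (h0 : r 0 = o) (hadj : ∀ i, (tree G U o).Adj (r i) (r (i + 1))) (N : ℕ) :
    ∃ m i, ∃ a : V × V, IsOutlet G U o m ∧ N ≤ i ∧ newDart G U (invasion G U o m) = some a ∧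
      (∀ j ≤ i, r j ∈ invasion G U o m) ∧ r i = a.1 ∧ r (i + 1) = a.2 := by
  induction N with
  | zero =>
    obtain ⟨m, -, hm⟩ := hout 0
    obtain ⟨a, ha⟩ := exists_newDart_eq_some (U := U) (boundaryDarts_invasion_nonempty hG U o m)
    obtain ⟨i, hin, h1, h2⟩ := ray_crosses_outlet hm ha hr h0 hadj
    exact ⟨m, i, a, hm, Nat.zero_le _, ha, hin, h1, h2⟩
  | succ N ih =>
    obtain ⟨m, i, a, -, hNi, ha, hin, -, h2⟩ := ih
    obtain ⟨m', hmm', hm'⟩ := hout (m + 1)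
    obtain ⟨a', ha'⟩ := exists_newDart_eq_some (U := U) (boundaryDarts_invasion_nonempty hG U o m')
    obtain ⟨i', hin', h1', h2'⟩ := ray_crosses_outlet hm' ha' hr h0 hadj
    have hI : ∀ j ≤ i + 1, r j ∈ invasion G U o m' := by
      intro j hj
      rcases Nat.lt_or_ge j (i + 1) with hj' | hj'
      · exact invasion_mono U o (by omega) (hin j (Nat.lt_succ_iff.1 hj'))
      · obtain rfl : j = i + 1 := le_antisymm hj hj'
        rw [h2]
        exact snd_mem_invasion_of_lt (by omega) ha
    have hlt : i + 1 ≤ i' := by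
      by_contra hlt
      have hmem := hI (i' + 1) (by omega)
      rw [h2'] at hmem
      exact snd_not_mem_of_newDart ha' hmem
    exact ⟨m', i', a', hm', by omega, ha', hin', h1', h2'⟩

/-- **ONE END (every graph, given outlets beyond every time).**  Any two self-avoiding rays of the invasion tree from the root coincide on an edge beyond
any prescribed index: `r i = r' i'` and `r (i+1) = r' (i'+1)` with `i ≥ N` — they have infinitely many common vertices, so they define the same end.
[cite: LyonsPeresSchramm2006, Thm. 3.12 (proof: "It follows that the invasion tree of o has a.s. one end")] -/
theorem rays_meet_beyond [Infinite V] (hG : G.Preconnected) {U : Sym2 V → ℝ} {o : V} (hout : ∀ k, ∃ m, k ≤ m ∧ IsOutlet G U o m)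
    {r r' : ℕ → V} (hr : Function.Injective r) (hr' : Function.Injective r') (h0 : r 0 = o) (h0' : r' 0 = o)
    (hadj : ∀ i, (tree G U o).Adj (r i) (r (i + 1))) (hadj' : ∀ i, (tree G U o).Adj (r' i) (r' (i + 1))) (N : ℕ) :
    ∃ i i', N ≤ i ∧ r i = r' i' ∧ r (i + 1) = r' (i' + 1) := by
  obtain ⟨m, i, a, hm, hNi, ha, -, h1, h2⟩ := exists_outlet_crossing_ge hG hout hr h0 hadj N
  obtain ⟨i', -, h1', h2'⟩ := ray_crosses_outlet hm ha hr' h0' hadj'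
  exact ⟨i, i', hNi, h1.trans h1'.symm, h2.trans h2'.symm⟩

end Summit.CriticalPhenomena.PercolationContinuityZ3.Theorems.Rsw3
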